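import Mathlib
import HarnessLib
import Literature.Analysis.Calculus.TaylorSegment
import Literature.Analysis.Calculus.ConvexFunctionalTrustRegion

/-!
# Item `LrcModEntire` (stmt-NavierStokesRegularity-20428), registry twist_split v7 — rung (H) of the «ridge quasiconvexity» lever (memo `Cruxes/LrcModEntire/T2B-g14.md` §9):
# THE TWO-VARIABLE SECOND-ORDER EXPANSION AT A CRITICAL POINT WITH A CUBIC REMAINDER (input `hH` of `…RidgeSecondOrder.abs_sSup_sub_le_of_ridgeExpansion`)

LEAD of item 20428 ns-poloidal-K2-p3 g14 (`--supports stmt-NavierStokesRegularity-20428 --as helper`).  CLASS-FREE calculus: for `f : E → ℝ` of class `C³` on a real normed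
space with a global third-derivative bound `‖D³f‖ ≤ C₃` (in `iteratedFDeriv` form — (F1) for a slice of a class profile) and a CRITICAL point `y` (`Df(y) = 0`: every hot
point), and two directions `ν, e` of norm `≤ 1` (the ridge normal and `e_z`):

* `ridgeExpansion_of_contDiff` — `|f(y + nν + ze) − (f(y) − ½κn² + αnz + ½βz²)| ≤ C₃(|n|+|z|)³` for ALL `n, z`, where `κ = −D²f(y)[ν,ν]`, `α = D²f(y)[ν,e]`, `β = D²f(y)[e,e]`
  (given by defining equations) — the scalar path `φ(τ) = f(y + τΔ)`, `Δ = nν + ze`, has `φ′(0) = 0`, `φ″(0) = D²f(y)[Δ,Δ]` (`Literature.Analysis.Calculus.hasDerivAt_comp_lineSegment`,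
  `hasDerivAt_fderiv_comp_lineSegment`) and `|φ″(s) − φ″(0)| ≤ s·C₃‖Δ‖³` (mean value inequality for `x ↦ D²f(x)` as `iteratedFDeriv ℝ 2 f`, `norm_fderiv_iteratedFDeriv`), so the
  path form `Literature.Analysis.Calculus.convexTR_taylor_path_le` applied to `±φ` gives the remainder `C₃‖Δ‖³/6 ≤ C₃(|n|+|z|)³`; symmetry of `D²f` (`ContDiffAt.isSymmSndFDerivAt`).

With `…LateralLevel.lateralLevel_persist` (LL), `…RidgeQuasiconvex.exists_end_ge_of_peakless` (Q1) and `…RidgeSecondOrder` (Q2) this completes the class-free chain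
«Peakless + C³ bounds + a hot arc with a tube chart ⇒ the second-order cross-section coefficient `θ_νz²/κ + θ_zz` is quasiconvex along the arc».

WHAT THIS IS NOT: not a claim about Navier–Stokes regularity — calculus for the research stubs `stub_T2b` / `stub_C2a'` / `stub_C2b'` (bears_on LADDER-NS N0, item 20428 / crux 19708;
both OPEN, ⟨27893⟩ OPEN).
-/

noncomputable section

-- the summit and its single sub-problem share the name (CONVENTIONS §1), as in every Theorems file
set_option linter.dupNamespace false

namespace Summit.NavierStokesRegularity.NavierStokesRegularity.Theorems.PoloidalWindowDoorLrcModEntireRidgeTaylor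

open Set Filter Topology Metric
open Literature.Analysis.Calculus

variable {E : Type*} [NormedAddCommGroup E] [NormedSpace ℝ E]

/-- Oscillation of the second derivative along a segment from a global bound on `D³f` (mean value inequality for `x ↦ iteratedFDeriv ℝ 2 f x`):
`|D²f(y+sΔ)[Δ,Δ] − D²f(y)[Δ,Δ]| ≤ s·C₃‖Δ‖³` for `0 ≤ s`. -/
theorem abs_snd_sub_le {f : E → ℝ} (hf : ContDiff ℝ 3 f) {C₃ : ℝ} (hC₃ : ∀ x, ‖iteratedFDeriv ℝ 3 f x‖ ≤ C₃) (y Δ : E) {s : ℝ} (hs : 0 ≤ s) :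
    |fderiv ℝ (fderiv ℝ f) (y + s • Δ) Δ Δ - fderiv ℝ (fderiv ℝ f) y Δ Δ| ≤ s * (C₃ * ‖Δ‖ ^ 3) := by
  set G : E → E [×2]→L[ℝ] ℝ := iteratedFDeriv ℝ 2 f with hG
  have hGd : Differentiable ℝ G := hf.differentiable_iteratedFDeriv (by norm_cast)
  have hGb : ∀ x, ‖fderiv ℝ G x‖ ≤ C₃ := fun x => by rw [hG, norm_fderiv_iteratedFDeriv]; exact hC₃ x
  have hmv : ‖G (y + s • Δ) - G y‖ ≤ C₃ * ‖y + s • Δ - y‖ :=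
    Convex.norm_image_sub_le_of_norm_fderiv_le (fun x _ => hGd x) (fun x _ => hGb x) convex_univ (mem_univ _) (mem_univ _)
  rw [add_sub_cancel_left, norm_smul, Real.norm_eq_abs, abs_of_nonneg hs] at hmv
  -- evaluate the difference of the multilinear maps on `(Δ, Δ)`
  have happ : (G (y + s • Δ) - G y) ![Δ, Δ] = fderiv ℝ (fderiv ℝ f) (y + s • Δ) Δ Δ - fderiv ℝ (fderiv ℝ f) y Δ Δ := by
    rw [sub_apply, hG, iteratedFDeriv_two_apply, iteratedFDeriv_two_apply]
    simp
  have hle := (G (y + s • Δ) - G y).le_opNorm ![Δ, Δ]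
  rw [happ, Fin.prod_univ_two] at hle
  simp only [Matrix.cons_val_zero, Matrix.cons_val_one, Real.norm_eq_abs] at hle
  calc |fderiv ℝ (fderiv ℝ f) (y + s • Δ) Δ Δ - fderiv ℝ (fderiv ℝ f) y Δ Δ| ≤ ‖G (y + s • Δ) - G y‖ * (‖Δ‖ * ‖Δ‖) := hle
    _ ≤ C₃ * (s * ‖Δ‖) * (‖Δ‖ * ‖Δ‖) := mul_le_mul_of_nonneg_right hmv (by positivity)
    _ = s * (C₃ * ‖Δ‖ ^ 3) := by ring

/-- **(H) THE RIDGE EXPANSION AT A CRITICAL POINT.**  `f ∈ C³(E)`, `‖D³f‖ ≤ C₃` (`iteratedFDeriv` form), `Df(y) = 0`, `‖ν‖, ‖e‖ ≤ 1`; with `κ := −D²f(y)[ν,ν]`, `α := D²f(y)[ν,e]`,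
`β := D²f(y)[e,e]`: `|f(y + nν + ze) − (f(y) − ½κn² + αnz + ½βz²)| ≤ C₃(|n| + |z|)³` for all real `n, z` — exactly the hypothesis `hH` of
`…RidgeSecondOrder.abs_sSup_sub_le_of_ridgeExpansion` (with `N = f y`, any `r`, `δ`). -/
theorem ridgeExpansion_of_contDiff {f : E → ℝ} (hf : ContDiff ℝ 3 f) {C₃ : ℝ} (hC₃ : ∀ x, ‖iteratedFDeriv ℝ 3 f x‖ ≤ C₃)
    {y : E} (hy : fderiv ℝ f y = 0) {ν e : E} (hν : ‖ν‖ ≤ 1) (he : ‖e‖ ≤ 1) {κ α β : ℝ}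
    (hκ : κ = -(fderiv ℝ (fderiv ℝ f) y ν ν)) (hα : α = fderiv ℝ (fderiv ℝ f) y ν e) (hβ : β = fderiv ℝ (fderiv ℝ f) y e e) (n z : ℝ) :
    |f (y + n • ν + z • e) - (f y - κ / 2 * n ^ 2 + α * n * z + β / 2 * z ^ 2)| ≤ C₃ * (|n| + |z|) ^ 3 := by
  set Δ : E := n • ν + z • e with hΔ
  have hf2 : ContDiff ℝ 2 f := hf.of_le (by norm_cast)
  have hfd : Differentiable ℝ f := hf.differentiable (by norm_cast)
  -- the scalar path and its two derivatives
  set φ : ℝ → ℝ := fun τ => f (y + τ • Δ) with hφ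
  set φ' : ℝ → ℝ := fun τ => fderiv ℝ f (y + τ • Δ) Δ with hφ'
  set φ'' : ℝ → ℝ := fun τ => fderiv ℝ (fderiv ℝ f) (y + τ • Δ) Δ Δ with hφ''
  have h1 : ∀ τ ∈ Icc (0:ℝ) 1, HasDerivAt φ (φ' τ) τ := fun τ _ => hasDerivAt_comp_lineSegment hfd y Δ τ
  have h2 : ∀ τ ∈ Icc (0:ℝ) 1, HasDerivAt φ' (φ'' τ) τ := fun τ _ => hasDerivAt_fderiv_comp_lineSegment hf2 y Δ τ
  set c : ℝ := C₃ * ‖Δ‖ ^ 3 with hc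
  have hlip : ∀ τ ∈ Icc (0:ℝ) 1, φ'' τ - φ'' 0 ≤ τ * c := fun τ hτ => by
    have h := abs_snd_sub_le hf hC₃ y Δ hτ.1
    simp only [hφ'', zero_smul, add_zero]
    exact (le_abs_self _).trans h
  have hlip' : ∀ τ ∈ Icc (0:ℝ) 1, (fun τ => -φ'' τ) τ - (fun τ => -φ'' τ) 0 ≤ τ * c := fun τ hτ => by
    have h := abs_snd_sub_le hf hC₃ y Δ hτ.1
    simp only [hφ'', zero_smul, add_zero]
    have h' := neg_le_abs (fderiv ℝ (fderiv ℝ f) (y + τ • Δ) Δ Δ - fderiv ℝ (fderiv ℝ f) y Δ Δ)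
    linarith
  -- the path form of the third-order bound, for `φ` and `−φ`
  have hup := (convexTR_taylor_path_le (φ := φ) (φ' := φ') (φ'' := φ'') zero_le_one h1 h2 hlip).2
  have hdn := (convexTR_taylor_path_le (φ := fun τ => -φ τ) (φ' := fun τ => -φ' τ) (φ'' := fun τ => -φ'' τ) zero_le_one
    (fun τ hτ => (h1 τ hτ).neg) (fun τ hτ => (h2 τ hτ).neg) hlip').2
  -- the values at `0`
  have hφ0 : φ 0 = f y := by simp [hφ]
  have hφ1 : φ 1 = f (y + n • ν + z • e) := by simp [hφ, hΔ, add_assoc]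
  have hφ'0 : φ' 0 = 0 := by simp [hφ', hy]
  have hsymm : fderiv ℝ (fderiv ℝ f) y e ν = fderiv ℝ (fderiv ℝ f) y ν e := by
    have hs : IsSymmSndFDerivAt ℝ f y := (hf.contDiffAt (x := y)).isSymmSndFDerivAt (by simp only [minSmoothness_of_isRCLikeNormedField]; norm_num)
    exact hs e ν
  have hφ''0 : φ'' 0 = -κ * n ^ 2 + 2 * α * n * z + β * z ^ 2 := by
    simp only [hφ'', zero_smul, add_zero]
    rw [hΔ, hκ, hα, hβ]
    simp only [map_add, map_smul, add_apply, FunLike.coe_smul, Pi.smul_apply, smul_eq_mul]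
    rw [hsymm]; ring
  -- `c/6 ≤ C₃ (|n|+|z|)³`
  have hC0 : 0 ≤ C₃ := (norm_nonneg _).trans (hC₃ y)
  have hΔle : ‖Δ‖ ≤ |n| + |z| := by
    rw [hΔ]
    refine (norm_add_le _ _).trans (add_le_add ?_ ?_)
    · rw [norm_smul, Real.norm_eq_abs]; exact mul_le_of_le_one_right (abs_nonneg _) hν
    · rw [norm_smul, Real.norm_eq_abs]; exact mul_le_of_le_one_right (abs_nonneg _) he
  have hc_le : c ≤ C₃ * (|n| + |z|) ^ 3 := by
    rw [hc]; exact mul_le_mul_of_nonneg_left (pow_le_pow_left₀ (norm_nonneg _) hΔle 3) hC0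
  have hc0 : 0 ≤ c := by rw [hc]; positivity
  rw [hφ0, hφ1, hφ'0, hφ''0] at hup
  simp only [hφ0, hφ1, hφ'0, hφ''0] at hdn
  rw [abs_le]
  constructor <;> nlinarith [hup, hdn, hc_le, hc0]

end Summit.NavierStokesRegularity.NavierStokesRegularity.Theorems.PoloidalWindowDoorLrcModEntireRidgeTaylor
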